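import Literature.Topology.FourManifolds.WhiteheadExtendF
import HarnessLib

/-!
# Whitehead triangulations, the extension step (Munkres 10.4), part X4c: purity of the glued complex

Continuation of `WhiteheadExtendF`: every simplex of the glued complex `G₃` is a face of a simplex
with `n + 1` vertices (`G₃_pure`).  Old faces use the purity of `K''`; new faces use the purity
theorem `ComplexTransport.exists_subset_card_eq_finrank_add_one` for the chart-space complex `H`
on the simplices lying in the inner box (the closure of the open box) or in the image of a top
straight simplex; the remaining new faces are lifts of unchanged simplices.

No named facts are introduced.
-/

open Set Function Metric Filter
open scoped Topology NNReal Manifold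

noncomputable section

-- `[T2Space M]` is a section variable used by most lemmas below; per-lemma `omit` would be noise.
set_option linter.unusedSectionVars false

namespace Literature.Topology.FourManifolds

open Literature.Analysis.Convexity Literature.Analysis.Convexity.SignArrangement

local notation "𝔼 " n:arg => EuclideanSpace ℝ (Fin n)

section BoxClosure

variable {n : ℕ}

/-- **A non-degenerate closed box is the closure of its open box** (one inclusion). [folklore] -/
theorem box_subset_closure_openBox {a b : Fin n → ℝ} (hab : ∀ i, a i < b i) :
    box a b ⊆ closure (openBox a b) := by
  intro x hx
  -- the centre of the box
  set c : 𝔼 n := (WithLp.equiv 2 (Fin n → ℝ)).symm fun i => (a i + b i) / 2 with hc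
  have hci : ∀ i, c i = (a i + b i) / 2 := fun i => rfl
  -- the segment from `x` towards `c` lies in the open box
  have hseg : ∀ t : ℝ, 0 < t → t ≤ 1 → x + t • (c - x) ∈ openBox a b := fun t ht0 ht1 i => by
    have h1 : (x + t • (c - x)) i = x i + t * (c i - x i) := by
      simp [hci]
    rw [h1, hci]
    have hxi := hx i
    have hai := hab i
    constructor <;> nlinarith
  -- and converges to `x`
  have hlim : Filter.Tendsto (fun t : ℝ => x + t • (c - x)) (𝓝[>] 0) (𝓝 x) := by
    have h : Filter.Tendsto (fun t : ℝ => x + t • (c - x)) (𝓝 0) (𝓝 (x + (0 : ℝ) • (c - x))) :=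
      ((continuous_const.add (continuous_id.smul continuous_const)).tendsto 0)
    rw [zero_smul, add_zero] at h
    exact h.mono_left nhdsWithin_le_nhds
  refine mem_closure_of_tendsto hlim ?_
  have : Ioc (0 : ℝ) 1 ∈ 𝓝[>] (0 : ℝ) := Ioc_mem_nhdsGT one_pos
  filter_upwards [this] with t ht
  exact hseg t ht.1 ht.2

end BoxClosure

namespace BendInput

variable {n N : ℕ} {M : Type*} [TopologicalSpace M] [T2Space M] {I : BendInput n N M}

namespace BendSetup

variable {S : BendSetup I} (X : ExtInput S)

namespace ExtInput

/-! ### Purity -/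

/-- Auxiliary (`card_newFace`). [folklore] -/
theorem card_newFace (ρ : Finset (𝔼 n)) : (S.newFace ρ).card = ρ.card := by
  classical
  unfold BendSetup.newFace
  convert Finset.card_image_of_injective ρ S.psi_injective

/-- Auxiliary (`card_oldFace`). [folklore] -/
theorem card_oldFace (σ : Finset (Fin N → ℝ)) : (S.oldFace σ).card = σ.card := by
  classical
  unfold BendSetup.oldFace
  convert Finset.card_image_of_injective σ oldV_injective

/-- Auxiliary (`newFace_mono`). [folklore] -/
theorem newFace_mono {ρ ρ' : Finset (𝔼 n)} (h : ρ ⊆ ρ') : S.newFace ρ ⊆ S.newFace ρ' := by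
  classical
  unfold BendSetup.newFace; exact Finset.image_subset_image h

/-- Auxiliary (`oldFace_mono`). [folklore] -/
theorem oldFace_mono {σ σ' : Finset (Fin N → ℝ)} (h : σ ⊆ σ') : S.oldFace σ ⊆ S.oldFace σ' := by
  classical
  unfold BendSetup.oldFace; exact Finset.image_subset_image h

/-- **P1**: a simplex of `H` inside the closure of the interior of `H.space` has a top coface, hence
its translation has one in `G₃`. [folklore] -/
theorem exists_top_of_closure {ρ : Finset (𝔼 n)} (hρ : ρ ∈ X.H.faces)
    (hcl : convexHull ℝ (ρ : Set (𝔼 n)) ⊆ closure (interior X.H.space)) :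
    ∃ T' ∈ X.G₃.faces, S.newFace ρ ⊆ T' ∧ T'.card = n + 1 := by
  classical
  obtain ⟨u, hu, hρu, hcard⟩ := exists_subset_card_eq_finrank_add_one X.H_finite hρ hcl
  rw [finrank_euclideanSpace_fin] at hcard
  exact ⟨S.newFace u, X.newFace_mem_G₃ hu, newFace_mono (S := S) hρu, by rw [card_newFace, hcard]⟩

/-- **P2**: the image of a top straight simplex lies in the closure of the interior of `H.space`.
[folklore] -/
theorem convexHull_rIm_subset_closure {t : Finset (Fin N → ℝ)} (ht : t ∈ S.Str) (hcard : t.card = n + 1) :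
    convexHull ℝ ((S.rIm t : Finset (𝔼 n)) : Set (𝔼 n)) ⊆ closure (interior X.H.space) := by
  classical
  have hind : AffineIndependent ℝ ((↑) : ↥(S.rIm t) → 𝔼 n) := S.affineIndependent_rIm ht
  have htop : affineSpan ℝ ((S.rIm t : Finset (𝔼 n)) : Set (𝔼 n)) = ⊤ := by
    have h2 := hind.affineSpan_eq_top_iff_card_eq_finrank_add_one
    rw [Subtype.range_coe] at h2
    exact h2.2 (by rw [Fintype.card_coe, S.card_rIm ht, hcard, finrank_euclideanSpace_fin])
  have hint : (interior (convexHull ℝ ((S.rIm t : Finset (𝔼 n)) : Set (𝔼 n)))).Nonempty := by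
    rw [interior_convexHull_nonempty_iff_affineSpan_eq_top]; exact htop
  have hsub : convexHull ℝ ((S.rIm t : Finset (𝔼 n)) : Set (𝔼 n)) ⊆ X.H.space :=
    (S.Q.convexHull_subset_space (S.rIm_mem_Q ht)).trans X.Q_space_subset_H
  calc convexHull ℝ ((S.rIm t : Finset (𝔼 n)) : Set (𝔼 n))
      ⊆ closure (interior (convexHull ℝ ((S.rIm t : Finset (𝔼 n)) : Set (𝔼 n)))) := by
        rw [(convex_convexHull ℝ _).closure_interior_eq_closure_of_nonempty_interior hint]
        exact subset_closure
    _ ⊆ closure (interior X.H.space) := closure_mono (interior_mono hsub)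

/-- **P3**: the inner box lies in the closure of the interior of `H.space`. [folklore] -/
theorem R₀_subset_closure : X.R₀ ⊆ closure (interior X.H.space) :=
  calc X.R₀ ⊆ closure (openBox X.a₀ X.b₀) := box_subset_closure_openBox fun i => (X.hbox i).2.1
    _ ⊆ closure (interior X.H.space) := closure_mono
        (interior_maximal ((openBox_subset_box _ _).trans X.R₀_subset_H) (isOpen_openBox _ _))

/-- A simplex of `K'` inside the image of an unchanged straight simplex is the image of one of its
faces. [folklore] -/
theorem exists_eq_rIm_of_subset {ρ : Finset (𝔼 n)} (hρ : ρ ∈ X.K'.faces) {u₀ : Finset (Fin N → ℝ)}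
    (hu₀s : u₀ ∈ S.Str) (hu₀U : u₀ ∈ X.U)
    (hsub : convexHull ℝ (ρ : Set (𝔼 n)) ⊆ S.Λ '' convexHull ℝ (u₀ : Set (Fin N → ℝ))) :
    ∃ σ : Finset (Fin N → ℝ), σ ⊆ u₀ ∧ σ.Nonempty ∧ S.rIm σ = ρ := by
  classical
  have hK'u : S.rIm u₀ ∈ X.K'.faces := X.kept_subset_K' (X.rIm_mem_kept hu₀s hu₀U)
  have hρu : ρ ⊆ S.rIm u₀ := by
    refine subset_of_bary_mem_convexHull hρ hK'u ?_
    rw [S.convexHull_rIm hu₀s]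
    exact hsub (bary_mem_convexHull (X.K'.nonempty_of_mem_faces hρ))
  refine ⟨u₀.filter fun v => S.Λ v ∈ ρ, Finset.filter_subset _ _, ?_, ?_⟩
  · obtain ⟨p, hp⟩ := X.K'.nonempty_of_mem_faces hρ
    have hp' := hρu hp
    unfold BendSetup.rIm at hp'
    obtain ⟨v, hv, rfl⟩ := Finset.mem_image.1 hp'
    exact ⟨v, Finset.mem_filter.2 ⟨hv, hp⟩⟩
  · unfold BendSetup.rIm
    ext p
    simp only [Finset.mem_image, Finset.mem_filter]
    constructor
    · rintro ⟨v, ⟨-, hvρ⟩, rfl⟩; exact hvρ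
    · intro hp
      have hp' := hρu hp
      unfold BendSetup.rIm at hp'
      obtain ⟨v, hv, rfl⟩ := Finset.mem_image.1 hp'
      exact ⟨v, ⟨hv, hp⟩, rfl⟩

/-- **P4**: old faces have top cofaces. [folklore] -/
theorem exists_top_old {σ : Finset (Fin N → ℝ)} (hσ : σ ∈ X.U) :
    ∃ T' ∈ X.G₃.faces, S.oldFace σ ⊆ T' ∧ T'.card = n + 1 := by
  obtain ⟨t', ht', hσt', hcard⟩ := S.Kb_pure hσ.1
  rcases X.mem_U_or_str ht' with hU | hstr
  · exact ⟨S.oldFace t', X.oldFace_mem_G₃ hU, oldFace_mono (S := S) hσt', by rw [card_oldFace, hcard]⟩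
  · -- `σ` is straight and unchanged: its face is the translation of `rIm σ ∈ H`
    have hσs : σ ∈ S.Str := S.str_down t' hstr σ hσt' (S.Kb.nonempty_of_mem_faces hσ.1)
    have hH : S.rIm σ ∈ X.H.faces := X.rIm_mem_H hσs hσ
    rw [← S.newFace_rIm hσs]
    refine X.exists_top_of_closure hH ((convexHull_mono ?_).trans (X.convexHull_rIm_subset_closure hstr hcard))
    classical
    unfold BendSetup.rIm
    exact_mod_cast Finset.image_subset_image hσt'

/-- **P5**: new faces have top cofaces. [folklore] -/
theorem exists_top_new {ρ : Finset (𝔼 n)} (hρ : ρ ∈ X.H.faces) :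
    ∃ T' ∈ X.G₃.faces, S.newFace ρ ⊆ T' ∧ T'.card = n + 1 := by
  rcases X.mem_H_faces.1 hρ with hK | hB
  · rcases X.K'_refines hK with ⟨s, ⟨t, ht, σ₀, hσ₀t, hne, rfl⟩, hsub⟩ | ⟨u, hu, -, hsub⟩
    · -- inside the image of a simplex of `T₁` (top and straight)
      refine X.exists_top_of_closure hρ (hsub.trans ((convexHull_mono ?_).trans
        (X.convexHull_rIm_subset_closure (X.t₁_subset_str ht) ht.2.1)))
      classical
      unfold BendSetup.rIm
      exact_mod_cast Finset.image_subset_image hσ₀t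
    · obtain ⟨u₀, hu₀, rfl⟩ := S.mem_Q_faces.1 hu
      obtain ⟨t', ht', hu₀t', hcard⟩ := S.Kb_pure hu₀.1
      rcases X.mem_U_or_str ht' with hU | hstr
      · -- `u₀` is unchanged: `ρ` is the image of a face of `u₀`, an old face
        have hu₀U : u₀ ∈ X.U := X.u_down t' hU u₀ hu₀t' (S.Kb.nonempty_of_mem_faces hu₀.1)
        rw [S.Q_hull hu₀] at hsub
        obtain ⟨σ, hσu₀, hσne, rfl⟩ := X.exists_eq_rIm_of_subset hK hu₀ hu₀U hsub
        have hσs : σ ∈ S.Str := S.str_down u₀ hu₀ σ hσu₀ hσne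
        rw [S.newFace_rIm hσs]
        exact ⟨S.oldFace t', X.oldFace_mem_G₃ hU, oldFace_mono (S := S) (hσu₀.trans hu₀t'), by rw [card_oldFace, hcard]⟩
      · refine X.exists_top_of_closure hρ (hsub.trans ((convexHull_mono ?_).trans
          (X.convexHull_rIm_subset_closure hstr hcard)))
        classical
        show ((u₀.image S.Λ : Finset (𝔼 n)) : Set (𝔼 n)) ⊆ ((S.rIm t' : Finset (𝔼 n)) : Set (𝔼 n))
        unfold BendSetup.rIm
        exact_mod_cast Finset.image_subset_image hu₀t'
  · exact X.exists_top_of_closure hρ (hB.2.trans X.R₀_subset_closure)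

/-- **The glued complex is pure.** [folklore] -/
theorem G₃_pure {T : Finset (V₃ n N)} (hT : T ∈ X.G₃.faces) : ∃ T' ∈ X.G₃.faces, T ⊆ T' ∧ T'.card = n + 1 := by
  rcases hT with ⟨σ, hσ, rfl⟩ | ⟨ρ, hρ, rfl⟩
  · exact X.exists_top_old hσ
  · exact X.exists_top_new hρ

end ExtInput

end BendSetup

end BendInput

end Literature.Topology.FourManifolds
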